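import Literature.NumberTheory.Rogawski1990.LocalNormFibreBadFrameClasses       -- ★ (CNT-a) FILE 1 F0P3a-p08: frame ⇒ blocks, rigidity, blocks ⇒ element (+ (b2), dock, B3-alg chain)
import Literature.NumberTheory.Rogawski1990.AdelicStableClassSupportFinite       -- ★ `isConj_of_charpoly_eq_of_separable`
import HarnessLib

/-!
# Classes realised in the bad frame, CM reading: a `Q′`-realised class matched with a `G`-regular `γ_H` ↔ a unitary block `B ∈ U(G₁′)` with `χ_B = χ_{γ_H.1}`
# (Rogawski 1990, §8.1 Prop. 8.1.3 pp. 110–111; §3.8 Prop. 3.8.1 (d)) — (CNT-a) FILE 2, the three arrows of `hcnt`'s frame bijection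

Topic `NumberTheory/Rogawski1990`; namespace `Literature.NumberTheory.Rogawski1990`.  THEOREMS ONLY (no definition, no instance, no notation, no named fact, no `sorry`).
Cell `pub/hodgecm-mathlib` (D-0151), crux H413 = stmt-HodgeConjecture-24833, floor-2 line «N6nsGerm», binder `hcnt` of ★ `exists_nhds_finsum_side_eq_stableOrbitalIntegralRel_of_compact_dock`
(B-p08 (g27), p842024) for F0P3a-p08's `Q′ γH γ := ∃ x B, (xγx⁻¹)·P′ = P′·(B ⊕ᶠ γH.2)` (★ `side_of_dock`); brick **(CNT-a) FILE 2** (LEAD F0P3a-plan (g9) T8-118); seat F0P3a-p08 (g13).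
HONEST LABEL: HC_CM is proved only modulo the printed citations until rung 0 closes; unconditional local algebra.

THE MATHEMATICS.  `P′` a frame of `H′_v` with block-diagonal Gram matrix `G₁′ ⊕ᶠ G₂′` (the bad frame, ★ `exists_badFrame_dock`), `γ_H = (g, u)` `G`-regular.
* (→) `matched_badFrame_block`: if `(xγx⁻¹)·P′ = P′·(B ⊕ᶠ u)` and `γ ↔ γ_H` then `B ∈ U(G₁′)` (★ FILE 1 `twistGram_blocks_of_frame`), `det B` is a unit and `χ_B = χ_g` (conjugation invariance,
  `χ_{B ⊕ᶠ u} = χ_B·(X − u)`, ★ `IsLocalNormPair.charpoly_eq`, cancel the monic factor).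
* (wd∕inj) `matched_badFrame_blocks_conj_iff`: two such realisations of `G′_v`-CONJUGATE elements have `U(G₁′)`-conjugate blocks (★ FILE 1 `exists_unitary_block_conj_of_conj`, the
  regularity `χ_B(u) ∈ E_vˣ` being ★ `isUnit_eval_finCharpolyTwo_of_isLocalGRegular`), and conversely `U(G₁′)`-conjugate blocks give `G′_v`-conjugate elements (★ `frame_conj_mem_unitaryGroup`
  on `k₁ ⊕ᶠ 1`).
* (←) `exists_matched_of_unitary_block`: every `B ∈ U(G₁′)` with `χ_B = χ_g` is the block of the matched element `P′(B ⊕ᶠ u)P′⁻¹ ∈ G′_v` (unitary by ★ `frame_conj_mem_unitaryGroup`; matched because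
  two invertible matrices over the field `E_v` with the same SEPARABLE characteristic polynomial are conjugate, ★ `isConj_of_charpoly_eq_of_separable`).
The `ncard`∕`Finite` transport of `hcnt` (the bijection on `ConjClasses`) is the sequel.

## References
* [Rogawski1990] J. D. Rogawski, *Automorphic Representations of Unitary Groups in Three Variables*, Ann. of Math. Stud. 123 (1990): §8.1 Prop. 8.1.3 pp. 110–111; §3.8 Prop. 3.8.1 (d) p. 30.
* [HornJohnson2013] R. A. Horn, C. R. Johnson, *Matrix Analysis*, 2nd ed. (2013), 3.3.P12.
-/

set_option autoImplicit false

noncomputable section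

open NumberField IsDedekindDomain Matrix Polynomial
open scoped MatrixGroups

namespace Literature.NumberTheory.Rogawski1990

open Literature.NumberTheory.Automorphic Literature.NumberTheory.Automorphic.UnitaryGroup
open Literature.AlgebraicGeometry.ShimuraVarieties (unitaryGroup mem_unitaryGroup_iff)

section CM

variable (L : Type) [Field L] [NumberField L] [IsCMField L] (H' : Matrix (Fin 3) (Fin 3) L) (v : HeightOneSpectrum (𝓞 ↥(maximalRealSubfield L)))

/-- A `1 × 1` matrix is the scalar matrix of its entry. [folklore] -/
private theorem fin_one_eq_smul_one₈ {S : Type*} [CommRing S] (C : Matrix (Fin 1) (Fin 1) S) : C = C 0 0 • (1 : Matrix (Fin 1) (Fin 1) S) := by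
  ext i j
  obtain rfl : i = 0 := Subsingleton.elim _ _
  obtain rfl : j = 0 := Subsingleton.elim _ _
  simp

/-- `χ_{B ⊕ᶠ C} = χ_B · χ_C`. [folklore] -/
private theorem charpoly_finSum₈ {S : Type*} [CommRing S] {N₁ N₂ : ℕ} (B : Matrix (Fin N₁) (Fin N₁) S) (C : Matrix (Fin N₂) (Fin N₂) S) :
    (finSum N₁ N₂ B C).charpoly = B.charpoly * C.charpoly := by
  rw [finSum, Matrix.charpoly_reindex, Matrix.charpoly_fromBlocks_zero₁₂]

/-- `χ_{u·1₁} = X − u`. [folklore] -/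
private theorem charpoly_smul_one_fin_one₈ {S : Type*} [CommRing S] (u : S) : (u • (1 : Matrix (Fin 1) (Fin 1) S)).charpoly = X - Polynomial.C u := by
  rw [Matrix.charpoly, Matrix.charmatrix, Matrix.det_fin_one]
  simp [Matrix.smul_apply, Matrix.one_apply_eq]

/-- `(A ⊕ᶠ B)(C ⊕ᶠ D) = AC ⊕ᶠ BD`. [folklore] -/
private theorem finSum_mul_finSum₉ {S : Type*} [CommRing S] {N₁ N₂ : ℕ} (A C : Matrix (Fin N₁) (Fin N₁) S) (B D : Matrix (Fin N₂) (Fin N₂) S) :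
    finSum N₁ N₂ A B * finSum N₁ N₂ C D = finSum N₁ N₂ (A * C) (B * D) := by
  simp only [finSum, Matrix.reindex_apply, Matrix.submatrix_mul_equiv, Matrix.fromBlocks_multiply, Matrix.mul_zero, Matrix.zero_mul,
    add_zero, zero_add]

/-- **(→) A MATCHED CLASS REALISED IN THE BAD FRAME HAS A UNITARY BLOCK WITH `χ_B = χ_{γ_H.1}`.** [cite: Rogawski1990, §8.1 Prop. 8.1.3 p. 110] -/
theorem matched_badFrame_block
    {P' : GL (Fin (2 + 1)) (LocalRing L v)} {G₁' : Matrix (Fin 2) (Fin 2) (LocalRing L v)} {G₂' : Matrix (Fin 1) (Fin 1) (LocalRing L v)}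
    (hP' : twistGram (conjLocal L (IsCMField.complexConj L) v) ((adelicForm L 3 H').map (adeleToLocal L v)) P'.val = finSum 2 1 G₁' G₂')
    (γH : ((cmDatum L 2 (Matrix.of fun i j : Fin 2 => if i.val + j.val + 1 = 2 then (1 : L) else 0)).Local v ×
      (cmDatum L 1 (Matrix.of fun i j : Fin 1 => if i.val + j.val + 1 = 1 then (1 : L) else 0)).Local v))
    {γ' x : (cmDatum L 3 H').Local v} (hm : IsLocalNormPair L H' v γH γ') {B : Matrix (Fin 2) (Fin 2) (LocalRing L v)}
    (hQ : ((x * γ' * x⁻¹).val.val : Matrix (Fin 3) (Fin 3) (LocalRing L v)) * P'.val = P'.val * finSum 2 1 B (γH.2.val.val : Matrix (Fin 1) (Fin 1) (LocalRing L v))) :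
    twistGram (conjLocal L (IsCMField.complexConj L) v) G₁' B = G₁' ∧ IsUnit B.det ∧ B.charpoly = finCharpolyTwo L v γH := by
  have hunit := (twistGram_blocks_of_frame (conjLocal L (IsCMField.complexConj L) v) (N₁ := 2) (N₂ := 1) _ hP' (x * γ' * x⁻¹).2 hQ).1
  have hdet := (isUnit_det_blocks_of_frame (N₁ := 2) (N₂ := 1) (γ := (x * γ' * x⁻¹).val) hQ).1
  refine ⟨hunit, hdet, ?_⟩
  -- characteristic polynomials: `χ_{xγx⁻¹} = χ_γ = χ_g (X − u)` and `χ_{xγx⁻¹} = χ_{B ⊕ᶠ u} = χ_B (X − u)`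
  have hb : (γH.2.val.val : Matrix (Fin 1) (Fin 1) (LocalRing L v)) = finGammaTwo L v γH • (1 : Matrix (Fin 1) (Fin 1) (LocalRing L v)) :=
    fin_one_eq_smul_one₈ _
  have h1 : ((x * γ' * x⁻¹).val.val : Matrix (Fin 3) (Fin 3) (LocalRing L v)).charpoly = finCharpolyTwo L v γH * (X - Polynomial.C (finGammaTwo L v γH)) := by
    have hmx : IsLocalNormPair L H' v γH (x * γ' * x⁻¹) := IsConj.trans hm (isConj_iff.2 ⟨x.val, rfl⟩)
    exact hmx.charpoly_eq
  have h2 : ((x * γ' * x⁻¹).val.val : Matrix (Fin 3) (Fin 3) (LocalRing L v)).charpoly = B.charpoly * (X - Polynomial.C (finGammaTwo L v γH)) := by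
    have hconj : ((x * γ' * x⁻¹).val.val : Matrix (Fin 3) (Fin 3) (LocalRing L v)) =
        P'.val * finSum 2 1 B (γH.2.val.val : Matrix (Fin 1) (Fin 1) (LocalRing L v)) * (P'⁻¹).val := by
      rw [← hQ, Matrix.mul_assoc, ← Units.val_mul, mul_inv_cancel, Units.val_one, Matrix.mul_one]
    rw [hconj, Matrix.coe_units_inv, Matrix.charpoly_units_conj, charpoly_finSum₈, hb, charpoly_smul_one_fin_one₈]
  have hreg : IsRightRegular (X - Polynomial.C (finGammaTwo L v γH)) := (monic_X_sub_C _).isRegular.right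
  exact (hreg (h2.symm.trans h1)).symm ▸ rfl

/-- **(wd) CONJUGATE MATCHED ELEMENTS REALISED IN THE BAD FRAME HAVE `U(G₁′)`-CONJUGATE BLOCKS** (`γ_H` `G`-regular: `χ_B(u)` is a unit).
[cite: Rogawski1990, §8.1 Prop. 8.1.3 pp. 110–111] -/
theorem exists_unitary_block_conj_of_matched_badFrame
    {P' : GL (Fin (2 + 1)) (LocalRing L v)} {G₁' : Matrix (Fin 2) (Fin 2) (LocalRing L v)} {G₂' : Matrix (Fin 1) (Fin 1) (LocalRing L v)}
    (hP' : twistGram (conjLocal L (IsCMField.complexConj L) v) ((adelicForm L 3 H').map (adeleToLocal L v)) P'.val = finSum 2 1 G₁' G₂')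
    {γH : ((cmDatum L 2 (Matrix.of fun i j : Fin 2 => if i.val + j.val + 1 = 2 then (1 : L) else 0)).Local v ×
      (cmDatum L 1 (Matrix.of fun i j : Fin 1 => if i.val + j.val + 1 = 1 then (1 : L) else 0)).Local v)} (hreg : IsLocalGRegular L v γH)
    {γ' γ'' x x' g : (cmDatum L 3 H').Local v} (hm : IsLocalNormPair L H' v γH γ') (hm' : IsLocalNormPair L H' v γH γ'') (hg : g * γ' * g⁻¹ = γ'')
    {B B₂ : Matrix (Fin 2) (Fin 2) (LocalRing L v)}
    (hQ : ((x * γ' * x⁻¹).val.val : Matrix (Fin 3) (Fin 3) (LocalRing L v)) * P'.val = P'.val * finSum 2 1 B (γH.2.val.val : Matrix (Fin 1) (Fin 1) (LocalRing L v)))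
    (hQ' : ((x' * γ'' * x'⁻¹).val.val : Matrix (Fin 3) (Fin 3) (LocalRing L v)) * P'.val = P'.val * finSum 2 1 B₂ (γH.2.val.val : Matrix (Fin 1) (Fin 1) (LocalRing L v))) :
    ∃ k₁ : Matrix (Fin 2) (Fin 2) (LocalRing L v), twistGram (conjLocal L (IsCMField.complexConj L) v) G₁' k₁ = G₁' ∧ IsUnit k₁.det ∧ k₁ * B = B₂ * k₁ := by
  have hb : (γH.2.val.val : Matrix (Fin 1) (Fin 1) (LocalRing L v)) = finGammaTwo L v γH • (1 : Matrix (Fin 1) (Fin 1) (LocalRing L v)) :=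
    fin_one_eq_smul_one₈ _
  have hχB : B.charpoly = finCharpolyTwo L v γH := (matched_badFrame_block L H' v hP' γH hm hQ).2.2
  have hχB₂ : B₂.charpoly = finCharpolyTwo L v γH := (matched_badFrame_block L H' v hP' γH hm' hQ').2.2
  have hχ : IsUnit (B.charpoly.eval (finGammaTwo L v γH)) := by rw [hχB]; exact isUnit_eval_finCharpolyTwo_of_isLocalGRegular L v γH hreg
  have hχ₂ : IsUnit (B₂.charpoly.eval (finGammaTwo L v γH)) := by rw [hχB₂]; exact isUnit_eval_finCharpolyTwo_of_isLocalGRegular L v γH hreg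
  rw [hb] at hQ hQ'
  have hgγ : g.val * γ'.val * (g.val)⁻¹ = γ''.val := by rw [← hg]; rfl
  exact exists_unitary_block_conj_of_conj (conjLocal L (IsCMField.complexConj L) v) (N₁ := 2) (N₂ := 1) _ hP' x.2 x'.2 g.2 hgγ hQ hQ' hχ hχ₂

/-- **(inj) `U(G₁′)`-CONJUGATE BLOCKS GIVE `G′_v`-CONJUGATE ELEMENTS**: if `(xγ′x⁻¹)P′ = P′(B ⊕ᶠ u)`, `(x′γ″x′⁻¹)P′ = P′(B₂ ⊕ᶠ u)` and `k₁B = B₂k₁` with `k₁ ∈ U(G₁′)` invertible, then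
`γ′` and `γ″` are conjugate in `G′_v` (by `x′⁻¹ · P′(k₁ ⊕ᶠ 1)P′⁻¹ · x`). [cite: Rogawski1990, §8.1 Prop. 8.1.3 pp. 110–111] -/
theorem exists_conj_of_unitary_block_conj
    {P' : GL (Fin (2 + 1)) (LocalRing L v)} {G₁' : Matrix (Fin 2) (Fin 2) (LocalRing L v)} {G₂' : Matrix (Fin 1) (Fin 1) (LocalRing L v)}
    (hP' : twistGram (conjLocal L (IsCMField.complexConj L) v) ((adelicForm L 3 H').map (adeleToLocal L v)) P'.val = finSum 2 1 G₁' G₂')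
    (γH : ((cmDatum L 2 (Matrix.of fun i j : Fin 2 => if i.val + j.val + 1 = 2 then (1 : L) else 0)).Local v ×
      (cmDatum L 1 (Matrix.of fun i j : Fin 1 => if i.val + j.val + 1 = 1 then (1 : L) else 0)).Local v))
    {γ' γ'' x x' : (cmDatum L 3 H').Local v} {B B₂ : Matrix (Fin 2) (Fin 2) (LocalRing L v)}
    (hQ : ((x * γ' * x⁻¹).val.val : Matrix (Fin 3) (Fin 3) (LocalRing L v)) * P'.val = P'.val * finSum 2 1 B (γH.2.val.val : Matrix (Fin 1) (Fin 1) (LocalRing L v)))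
    (hQ' : ((x' * γ'' * x'⁻¹).val.val : Matrix (Fin 3) (Fin 3) (LocalRing L v)) * P'.val = P'.val * finSum 2 1 B₂ (γH.2.val.val : Matrix (Fin 1) (Fin 1) (LocalRing L v)))
    {k₁ : Matrix (Fin 2) (Fin 2) (LocalRing L v)} (hk₁ : twistGram (conjLocal L (IsCMField.complexConj L) v) G₁' k₁ = G₁') (hk₁d : IsUnit k₁.det) (hkB : k₁ * B = B₂ * k₁) :
    ∃ g : (cmDatum L 3 H').Local v, g * γ' * g⁻¹ = γ'' := by
  -- `T := k₁ ⊕ᶠ 1` as a unit, and the unitary `u := P′TP′⁻¹`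
  have hTd : IsUnit (finSum 2 1 k₁ (1 : Matrix (Fin 1) (Fin 1) (LocalRing L v))).det := by rw [det_finSum, Matrix.det_one, mul_one]; exact hk₁d
  set T : GL (Fin (2 + 1)) (LocalRing L v) := Matrix.nonsingInvUnit _ hTd with hT
  have hTv : T.val = finSum 2 1 k₁ (1 : Matrix (Fin 1) (Fin 1) (LocalRing L v)) := rfl
  have hG₂ : twistGram (conjLocal L (IsCMField.complexConj L) v) G₂' (1 : Matrix (Fin 1) (Fin 1) (LocalRing L v)) = G₂' := twistGram_one _ _
  have huU := frame_conj_mem_unitaryGroup (conjLocal L (IsCMField.complexConj L) v) (N₁ := 2) (N₂ := 1) _ hP' hTv hk₁ hG₂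
  set u : (cmDatum L 3 H').Local v := ⟨P' * T * P'⁻¹, huU⟩ with hu
  -- the block elements as units: `xγ′x⁻¹ = P′FP′⁻¹`, `x′γ″x′⁻¹ = P′F₂P′⁻¹`, and `TFT⁻¹ = F₂`
  obtain ⟨F, hF, hFv⟩ : ∃ F : GL (Fin (2 + 1)) (LocalRing L v), (x * γ' * x⁻¹).val = P' * F * P'⁻¹ ∧
      F.val = finSum 2 1 B (γH.2.val.val : Matrix (Fin 1) (Fin 1) (LocalRing L v)) :=
    ⟨P'⁻¹ * (x * γ' * x⁻¹).val * P', by group, by rw [Units.val_mul, Units.val_mul, Matrix.mul_assoc, hQ, ← Matrix.mul_assoc, Units.inv_mul, Matrix.one_mul]⟩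
  obtain ⟨F₂, hF₂, hF₂v⟩ : ∃ F₂ : GL (Fin (2 + 1)) (LocalRing L v), (x' * γ'' * x'⁻¹).val = P' * F₂ * P'⁻¹ ∧
      F₂.val = finSum 2 1 B₂ (γH.2.val.val : Matrix (Fin 1) (Fin 1) (LocalRing L v)) :=
    ⟨P'⁻¹ * (x' * γ'' * x'⁻¹).val * P', by group, by rw [Units.val_mul, Units.val_mul, Matrix.mul_assoc, hQ', ← Matrix.mul_assoc, Units.inv_mul, Matrix.one_mul]⟩
  have hTB : finSum 2 1 k₁ (1 : Matrix (Fin 1) (Fin 1) (LocalRing L v)) * finSum 2 1 B (γH.2.val.val : Matrix (Fin 1) (Fin 1) (LocalRing L v)) =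
      finSum 2 1 B₂ (γH.2.val.val : Matrix (Fin 1) (Fin 1) (LocalRing L v)) * finSum 2 1 k₁ (1 : Matrix (Fin 1) (Fin 1) (LocalRing L v)) := by
    rw [finSum_mul_finSum₉, finSum_mul_finSum₉, hkB, Matrix.one_mul, Matrix.mul_one]
  have hTF : T * F * T⁻¹ = F₂ := by
    rw [mul_inv_eq_iff_eq_mul]
    exact Units.ext (by rw [Units.val_mul, Units.val_mul, hTv, hFv, hF₂v, hTB])
  have key : u.val * (x * γ' * x⁻¹).val * (u.val)⁻¹ = (x' * γ'' * x'⁻¹).val := by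
    rw [hF, hF₂, ← hTF, show u.val = P' * T * P'⁻¹ from rfl]
    group
  refine ⟨x'⁻¹ * u * x, ?_⟩
  have key' : u * (x * γ' * x⁻¹) * u⁻¹ = x' * γ'' * x'⁻¹ := Subtype.ext key
  calc x'⁻¹ * u * x * γ' * (x'⁻¹ * u * x)⁻¹ = x'⁻¹ * (u * (x * γ' * x⁻¹) * u⁻¹) * x' := by group
    _ = γ'' := by rw [key']; group

/-- **(←) EVERY UNITARY BLOCK WITH `χ_B = χ_{γ_H.1}` IS REALISED BY A MATCHED ELEMENT IN THE BAD FRAME**: `γ′ := P′(B ⊕ᶠ u)P′⁻¹ ∈ G′_v`, matched with the `G`-regular `γ_H`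
(same separable characteristic polynomial over the field `E_v`, `v` non-split). [cite: Rogawski1990, §8.1 Prop. 8.1.3 pp. 110–111] [cite: HornJohnson2013, 3.3.P12] -/
theorem exists_matched_of_unitary_block (w : PlacesOver L v) (hw : IsCMField.complexConj L • w.1 = w.1)
    {P' : GL (Fin (2 + 1)) (LocalRing L v)} {G₁' : Matrix (Fin 2) (Fin 2) (LocalRing L v)} {G₂' : Matrix (Fin 1) (Fin 1) (LocalRing L v)}
    (hP' : twistGram (conjLocal L (IsCMField.complexConj L) v) ((adelicForm L 3 H').map (adeleToLocal L v)) P'.val = finSum 2 1 G₁' G₂')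
    {γH : ((cmDatum L 2 (Matrix.of fun i j : Fin 2 => if i.val + j.val + 1 = 2 then (1 : L) else 0)).Local v ×
      (cmDatum L 1 (Matrix.of fun i j : Fin 1 => if i.val + j.val + 1 = 1 then (1 : L) else 0)).Local v)} (hreg : IsLocalGRegular L v γH)
    {B : Matrix (Fin 2) (Fin 2) (LocalRing L v)} (hB : twistGram (conjLocal L (IsCMField.complexConj L) v) G₁' B = G₁') (hBd : IsUnit B.det)
    (hχ : B.charpoly = finCharpolyTwo L v γH) :
    ∃ γ' : (cmDatum L 3 H').Local v, IsLocalNormPair L H' v γH γ' ∧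
      (γ'.val.val : Matrix (Fin 3) (Fin 3) (LocalRing L v)) * P'.val = P'.val * finSum 2 1 B (γH.2.val.val : Matrix (Fin 1) (Fin 1) (LocalRing L v)) := by
  haveI : Algebra.IsQuadraticExtension ↥(maximalRealSubfield L) L := IsCMField.isQuadraticExtension L
  obtain ⟨δ, hcδ, hδ⟩ : ∃ δ : L, IsCMField.complexConj L δ = -δ ∧ δ ≠ 0 := by
    have hne : IsCMField.complexConj L ≠ 1 := IsCMField.complexConj_ne_one (K := L)
    obtain ⟨z, hz⟩ : ∃ z : L, IsCMField.complexConj L z ≠ z := by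
      by_contra hall
      exact hne (AlgEquiv.ext fun z => not_not.mp (not_exists.mp hall z))
    refine ⟨z - IsCMField.complexConj L z, ?_, sub_ne_zero.2 (Ne.symm hz)⟩
    rw [map_sub, IsCMField.complexConj_apply_apply, neg_sub]
  have hb : (γH.2.val.val : Matrix (Fin 1) (Fin 1) (LocalRing L v)) = finGammaTwo L v γH • (1 : Matrix (Fin 1) (Fin 1) (LocalRing L v)) :=
    fin_one_eq_smul_one₈ _
  have hu1 : conjLocal L (IsCMField.complexConj L) v (finGammaTwo L v γH) * finGammaTwo L v γH = 1 := conjLocal_finGammaTwo_mul_finGammaTwo L v γH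
  -- the second block is unitary for `G₂′`
  have hG₂ : twistGram (conjLocal L (IsCMField.complexConj L) v) G₂' (γH.2.val.val : Matrix (Fin 1) (Fin 1) (LocalRing L v)) = G₂' := by
    rw [hb, twistGram_def]
    refine Matrix.ext fun i j => ?_
    obtain rfl : i = 0 := Subsingleton.elim _ _
    obtain rfl : j = 0 := Subsingleton.elim _ _
    simp only [Matrix.mul_apply, Fin.sum_univ_one, Matrix.transpose_apply, Matrix.map_apply, Matrix.smul_apply, Matrix.one_apply_eq, smul_eq_mul,
      mul_one, Fin.isValue]
    linear_combination (G₂' 0 0) * hu1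
  -- `T := B ⊕ᶠ u` as a unit and `γ′ := P′TP′⁻¹ ∈ G′_v`
  have hTd : IsUnit (finSum 2 1 B (γH.2.val.val : Matrix (Fin 1) (Fin 1) (LocalRing L v))).det := by
    rw [det_finSum]; exact hBd.mul (Matrix.isUnits_det_units _)
  set T : GL (Fin (2 + 1)) (LocalRing L v) := Matrix.nonsingInvUnit _ hTd with hT
  have hTv : T.val = finSum 2 1 B (γH.2.val.val : Matrix (Fin 1) (Fin 1) (LocalRing L v)) := rfl
  have hmem := frame_conj_mem_unitaryGroup (conjLocal L (IsCMField.complexConj L) v) (N₁ := 2) (N₂ := 1) _ hP' hTv hB hG₂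
  refine ⟨⟨P' * T * P'⁻¹, hmem⟩, ?_, ?_⟩
  · -- matched: same separable characteristic polynomial over the field `E_v`
    letI : Field (LocalRing L v) :=
      (Liu2021.LemD1IndexedNonVacuityNonsplitPlace.isField_localRing_of_nonsplit L v (IsCMField.complexConj L) hcδ hδ w hw).toField
    have hsep : (((endoEmbLocal L v γH).val.val : Matrix (Fin 3) (Fin 3) (LocalRing L v)).charpoly).Separable := by
      rw [charpoly_endoEmbLocal]; exact hreg.separable_mul L v
    have hchar : ((endoEmbLocal L v γH).val.val : Matrix (Fin 3) (Fin 3) (LocalRing L v)).charpoly =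
        ((P' * T * P'⁻¹).val : Matrix (Fin 3) (Fin 3) (LocalRing L v)).charpoly := by
      rw [charpoly_endoEmbLocal, Units.val_mul, Units.val_mul, Matrix.coe_units_inv, Matrix.charpoly_units_conj, hTv, charpoly_finSum₈, hb,
        charpoly_smul_one_fin_one₈, hχ]
    exact isConj_of_charpoly_eq_of_separable _ _ hsep hchar
  · change ((P' * T * P'⁻¹).val : Matrix (Fin 3) (Fin 3) (LocalRing L v)) * P'.val = _
    rw [Units.val_mul, Matrix.mul_assoc, Units.inv_mul, Matrix.mul_one, Units.val_mul, hTv]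

end CM

end Literature.NumberTheory.Rogawski1990

end
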